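import Summits.ValiantsHypothesis.ValiantsHypothesis.Theorems.LacunarySymmetroidMatrixDescartesCensusDoorA34HollowCornerChart
import Summits.ValiantsHypothesis.ValiantsHypothesis.Theorems.LacunarySymmetroidMatrixDescartesCensusDoorA34Lift

/-!
# `MatrixDescartes` census — DOOR A at `(3,4)`: the line pair `m nᵀ + n mᵀ` — adjugate, vertex, and the meaning of the hollow-corner
# non-degeneracy `(m × n)ᵀ B₁ (m × n) ≠ 0` (SIMPLICITY of the degenerate member in the annihilator pencil)

HONEST FRAMING.  Object-search cell `pub-symmetroid`, door-A seat `val-sym-door-p3` (g17); item stmt-ValiantsHypothesis-19980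
`DoorA34 = PosRootLawAt 3 4 18` is OPEN and asserted nowhere here.  Nothing here bounds `ζ_sym(3,4)`; nothing bears on `MatrixDescartes`
(stmt-ValiantsHypothesis-18050) or on `VP ≠ VNP`.

CONTENT (pure `3 × 3` identities over `ℝ`; no `def`, no `sorry`).  For the real line pair `K = m nᵀ + n mᵀ` of `…CensusDoorA34HollowCornerChart`:
* `det_linePair` — `det K = 0`; `linePair_mulVec_cross` — `K (m × n) = 0` (the vertex); **`adjugate_linePair`** — `adj K = −(m × n)(m × n)ᵀ`;
* `trace_adjugate_linePair_mul` — `tr(adj K · B) = −(m × n)ᵀ B (m × n)`;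
* **`det_linePair_add_smul`** — along the pencil, `det (K + c·B) = c·(−(m × n)ᵀB(m × n)) + c²·tr(adj B · K) + c³·det B`
  (`Census.det_add_smul_fin_three`): the parameter of `K` is a root of the pencil's binary cubic, and it is a SIMPLE root iff
  `(m × n)ᵀ B (m × n) ≠ 0` — which is exactly the non-degeneracy hypothesis `ha` of `EqualDiagonal.exists_congr_hollowCorner`.
So the hollow-corner chart applies to every net whose annihilator pencil has a SIMPLE real root carrying a real line pair.
[folklore] Elementary.
-/

-- `Summit.ValiantsHypothesis.ValiantsHypothesis.…` repeats a component by the D-0017 layout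
-- (single-conjunct summit), which the `dupNamespace` linter flags; the name is mandated.
set_option linter.dupNamespace false

namespace Summit.ValiantsHypothesis.ValiantsHypothesis.Theorems.LacunarySymmetroidMatrixDescartes.Census.EqualDiagonal

open Matrix Finset
open scoped BigOperators

/-- The line pair is singular. [folklore] -/
theorem det_linePair (m n : Fin 3 → ℝ) : (vecMulVec m n + vecMulVec n m).det = 0 := by
  simp [Matrix.det_fin_three, vecMulVec_apply]
  ring

/-- Its vertex `m × n` is in the kernel. [folklore] -/
theorem linePair_mulVec_cross (m n : Fin 3 → ℝ) : (vecMulVec m n + vecMulVec n m) *ᵥ (m ⨯₃ n) = 0 := by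
  ext i
  fin_cases i <;> simp [Matrix.mulVec, dotProduct, vecMulVec_apply, cross_apply, Fin.sum_univ_three] <;> ring

/-- **Adjugate of a line pair**: `adj (m nᵀ + n mᵀ) = −(m × n)(m × n)ᵀ`. [folklore] -/
theorem adjugate_linePair (m n : Fin 3 → ℝ) :
    (vecMulVec m n + vecMulVec n m).adjugate = -vecMulVec (m ⨯₃ n) (m ⨯₃ n) := by
  ext i j
  fin_cases i <;> fin_cases j <;>
    simp [Matrix.adjugate_fin_three, vecMulVec_apply, cross_apply] <;> ring

/-- `tr(adj(m nᵀ + n mᵀ) · B) = −(m × n)ᵀ B (m × n)`. [folklore] -/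
theorem trace_adjugate_linePair_mul (m n : Fin 3 → ℝ) (B : Matrix (Fin 3) (Fin 3) ℝ) :
    ((vecMulVec m n + vecMulVec n m).adjugate * B).trace = -((m ⨯₃ n) ⬝ᵥ (B *ᵥ (m ⨯₃ n))) := by
  rw [adjugate_linePair]
  simp [Matrix.trace, Matrix.mul_apply, vecMulVec_apply, dotProduct, Matrix.mulVec, Fin.sum_univ_three]
  ring

/-- **The pencil through a line pair**: `det (K + c·B) = c·(−(m × n)ᵀB(m × n)) + c²·tr(adj B · K) + c³·det B` for `K = m nᵀ + n mᵀ`.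
Hence the parameter of `K` in the pencil `{K + cB}` is a SIMPLE root of the binary cubic `det` iff `(m × n)ᵀ B (m × n) ≠ 0` — the
hypothesis `ha` of `exists_congr_hollowCorner`. [folklore] -/
theorem det_linePair_add_smul (m n : Fin 3 → ℝ) (B : Matrix (Fin 3) (Fin 3) ℝ) (c : ℝ) :
    (vecMulVec m n + vecMulVec n m + c • B).det
      = c * (-((m ⨯₃ n) ⬝ᵥ (B *ᵥ (m ⨯₃ n)))) + c ^ 2 * (B.adjugate * (vecMulVec m n + vecMulVec n m)).trace + c ^ 3 * B.det := by
  rw [det_add_smul_fin_three, det_linePair, trace_adjugate_linePair_mul, zero_add]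

/-- `det(K + cB) = c · g(c)` with `g(0) = −(m × n)ᵀB(m × n)`: the root `c = 0` of the pencil's cubic is simple iff the vertex of the line
pair is not `B`-isotropic. [folklore] -/
theorem det_linePair_add_smul_eq_mul (m n : Fin 3 → ℝ) (B : Matrix (Fin 3) (Fin 3) ℝ) (c : ℝ) :
    (vecMulVec m n + vecMulVec n m + c • B).det
      = c * (-((m ⨯₃ n) ⬝ᵥ (B *ᵥ (m ⨯₃ n))) + c * (B.adjugate * (vecMulVec m n + vecMulVec n m)).trace + c ^ 2 * B.det) := by
  rw [det_linePair_add_smul]; ring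

end Summit.ValiantsHypothesis.ValiantsHypothesis.Theorems.LacunarySymmetroidMatrixDescartes.Census.EqualDiagonal
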